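import Mathlib
import Summits.QuantumFields.BalabanUV.Beta.UnitLatticeOmegaPaths
import Summits.QuantumFields.BalabanUV.Beta.AnalyticWalkSum216RowData

/-!
# `Summit.QuantumFields.BalabanUV.Beta.UnitLatticeOmegaRowData` — A3-loc-ω (IV): the FULLY DECORATED ω-expansion
# (cube-chain cells AND kernel-piece domains), one free coordinate `s(Δ₀) = σ` at a time, IS an
# `AnalyticWalkSum216RowData.RowData` family on `‖σ‖ < e^{κ₁}` with majorant `e^{κ₁P}·walkMajΩ (κ₁P/r)` and constant
# `e^{κ₁P}·N·C_L′·(1 − ρ_Ω)⁻¹`, `ρ_Ω = C_L′·((2N/M)·K₁″ + Φ)` — no tube hypothesis left (packing, diameters, threads in);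
# at `s ≡ 1` its sum is `(1 + Σ_ω K_ω)⁻¹`

HONEST FRAMING (page 1 of everything in this cell).  Discharging `FlowStep.BetaPertH` would make Bałaban's ultraviolet
stability UNCONDITIONAL — a constructive-QFT result; NOT the continuum limit, NOT the Clay problem.  This module
discharges nothing of `BetaPertH`; [folklore] bookkeeping, kernel-checked (unit `b2b-balaban-beta-d4-p3`, road P3, gen 4;
skeleton v1.9 §7.6 «A3-loc-ω»; the row owner's volume-free currency `RowData` BY NAME).  HONEST COSTS (displayed in the
hypotheses, not hidden): the rate condition `κ + κ₁P/r ≤ κ₀` (Bałaban's R1) on the budgets `C_L′, K₁″, Φ`; the per-step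
credit `e^{(κ₁P/r)·cr(ω)}`, `cr(ω) ≥ 3·len(ω) + 2·D_f`, inside `K₁″` and `Φ`; symmetry of `d`.
HONEST DEPENDENCY: continuum YM on T⁴ ⇐ BetaPertH ∧ nine spine estimates (0/9 proved); BetaPertH ⇐
(D1) ∧ (D4) ∧ CAP+tail; G-an2-4 gates asym, D1 and NE2/3/4.

CONTENTS (0 sorry).  §1 `monoAt τ Δ₀ S σ = Π_{Δ∈S} s(Δ)` with `s(Δ₀) = σ` (entire; `≤ r^{#S}`; `= 1` at `τ ≡ 1, σ = 1`).
§2 index type `WalkΩ B Ω = Σ n, B × (Fin n → B × Ω)`, the family `decFamilyΩ`, the majorant `decMajΩ`, fibre sums,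
`summable_decMajΩ`, `row_majSum_decMajΩ_le`.  §3 **`rowData_decFamilyΩ`** (the hand-off; hypothesis-free decoration
`decΩ cellOf E Dω`).  §4 `inv_one_add_eq'` (generic) and **`termSum_decFamilyΩ_one`**: at `s ≡ 1` the summed family is
`(1 + Ktot K)⁻¹` (`resummation_identity₂` ∕ `Ptot_mul_Rem₂_pow` ∕ `AnalyticWalkSum216Neumann.hasSum_pow_apply` BY NAME).
NOT HERE: any instance on Bałaban's operators ((T3), NODE O.2 untouched).  NOT summit progress.
-/

open scoped BigOperators Matrix
open Finset Matrix Metric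

namespace Summit.QuantumFields.BalabanUV.Beta.UnitLatticeOmegaRowData

open Summit.QuantumFields.BalabanUV.Beta.UnitLatticeWalkInversion
open Summit.QuantumFields.BalabanUV.Beta.UnitLatticeDecoratedPaths (headMajPSum wrs_headMajPSum)
open Summit.QuantumFields.BalabanUV.Beta.UnitLatticeTubeCount (pathLen)
open Summit.QuantumFields.BalabanUV.Beta.UnitLatticeOmegaTerms
open Summit.QuantumFields.BalabanUV.Beta.UnitLatticeOmegaTube (crSum decΩ card_decΩ_le listLen)
open Summit.QuantumFields.BalabanUV.Beta.UnitLatticeOmegaPaths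
open Summit.QuantumFields.BalabanUV.Beta.AnalyticWalkSum216 (termSum majSum)
open Summit.QuantumFields.BalabanUV.Beta.AnalyticWalkSum216RowData (RowData)
open Summit.QuantumFields.BalabanUV.Beta.AnalyticWalkSum216Neumann (hasSum_pow_apply)
open Literature.MathematicalPhysics.QuantumFieldTheory.Balaban1983to89.B13PerturbativeStep
  (wrs WRS WeightHyp isUnit_one_sub)

noncomputable section

variable {Y : Type*} [Fintype Y] [DecidableEq Y] {B Ω : Type*} [DecidableEq Ω] {Δ : Type*} [DecidableEq Δ]

/-! ## §1 The decoration monomial of a finite cell set, one coordinate free -/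

/-- `monoAt τ Δ₀ S σ := Π_{Δ ∈ S} s(Δ)` with `s = τ` except `s(Δ₀) = σ`. [folklore] -/
def monoAt (τ : Δ → ℂ) (Δ₀ : Δ) (S : Finset Δ) (σ : ℂ) : ℂ := ∏ δ ∈ S, Function.update τ Δ₀ σ δ

omit [DecidableEq Δ] in
/-- `σ ↦ monoAt τ Δ₀ S σ` is complex-differentiable on every set. [folklore] -/
theorem differentiableOn_monoAt [DecidableEq Δ] (τ : Δ → ℂ) (Δ₀ : Δ) (S : Finset Δ) (U : Set ℂ) :
    DifferentiableOn ℂ (fun σ => monoAt τ Δ₀ S σ) U := by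
  unfold monoAt
  refine DifferentiableOn.fun_finsetProd fun δ _ => ?_
  by_cases hδ : δ = Δ₀
  · subst hδ
    simp only [Function.update_self]
    exact differentiableOn_id
  · simp only [Function.update_of_ne hδ]
    exact differentiableOn_const _

omit [DecidableEq Δ] in
/-- On `‖σ‖ ≤ r` with `‖τ(Δ)‖ ≤ r`: `‖monoAt τ Δ₀ S σ‖ ≤ r^{#S}`. [folklore] -/
theorem norm_monoAt_le [DecidableEq Δ] {τ : Δ → ℂ} {r : ℝ} (hτ : ∀ δ, ‖τ δ‖ ≤ r) (Δ₀ : Δ) (S : Finset Δ) {σ : ℂ}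
    (hσ : ‖σ‖ ≤ r) : ‖monoAt τ Δ₀ S σ‖ ≤ r ^ S.card := by
  unfold monoAt
  rw [norm_prod, ← Finset.prod_const]
  exact Finset.prod_le_prod (fun _ _ => norm_nonneg _) fun δ _ => by
    by_cases hδ : δ = Δ₀
    · subst hδ
      rwa [Function.update_self]
    · rw [Function.update_of_ne hδ]
      exact hτ δ

omit [DecidableEq Δ] in
/-- At `τ ≡ 1`, `σ = 1` the monomial is `1`. [folklore] -/
theorem monoAt_one [DecidableEq Δ] (Δ₀ : Δ) (S : Finset Δ) : monoAt (fun _ => (1 : ℂ)) Δ₀ S 1 = 1 := by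
  unfold monoAt
  rw [Function.update_eq_self_iff.2 rfl]
  exact Finset.prod_const_one

/-! ## §2 The decorated ω-family and its majorant -/

/-- The index type of the ω-expansion to ALL orders: a length `n`, a head cube `b₀`, steps `(b_t, ω_t)`. [folklore] -/
abbrev WalkΩ (B Ω : Type*) := Σ n : ℕ, B × (Fin n → B × Ω)

/-- THE DECORATED ω-FAMILY with the coordinate `Δ₀` free: `(n; b₀, c⃗) ↦ (σ ↦ monoAt τ Δ₀ (decΩ n b₀ c⃗) σ • walkTermΩ n b₀ c⃗)`.
[folklore] -/
def decFamilyΩ (cellOf : Y → Δ) (E : B → Finset Y) (Dω : Ω → Finset Y) (h : B → Y → ℝ) (K : Ω → Matrix Y Y ℂ)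
    (near : B → Finset Ω) (L : B → Matrix Y Y ℂ) (τ : Δ → ℂ) (Δ₀ : Δ) : WalkΩ B Ω → ℂ → Matrix Y Y ℂ :=
  fun w σ => monoAt τ Δ₀ (decΩ cellOf E Dω w.1 w.2.1 w.2.2) σ • walkTermΩ h K near L w.1 w.2.1 w.2.2

/-- ITS MAJORANT `A₀·walkMajΩ δ n b₀ c⃗`. [folklore] -/
def decMajΩ (A₀ δ : ℝ) (d : Y → Y → ℝ) (cr : Ω → ℝ) (h : B → Y → ℝ) (K : Ω → Matrix Y Y ℂ) (near : B → Finset Ω)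
    (L : B → Matrix Y Y ℂ) : WalkΩ B Ω → Y → Y → ℝ :=
  fun w i j => A₀ * walkMajΩ δ d cr h K near L w.1 w.2.1 w.2.2 i j

section Wrs

variable {κ : ℝ} {d : Y → Y → ℝ}

/-- The ratio `ρ_Ω = C_L′·((2N/M)·K₁″ + Φ)` is nonnegative under the standing hypotheses. [folklore] -/
theorem ratio_nonneg [Fintype B] [Fintype Ω] (hw : WeightHyp κ d) {δ : ℝ} (cr : Ω → ℝ) (K : Ω → Matrix Y Y ℂ)
    (near : B → Finset Ω) (h : B → Y → ℝ) (E : B → Finset Y) {M N C_L K₁ Φ : ℝ} (hM : 0 < M)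
    (hN : ∀ y, ((Finset.univ.filter fun b => y ∈ E b).card : ℝ) ≤ N) (hC : 0 ≤ C_L)
    (hK₁ : ∀ k, ∑ ω, ∑ l, ‖K ω k l‖ * d k l * Real.exp ((κ + δ) * d k l + δ * cr ω) ≤ K₁)
    (hΦ : ∀ k, ∑ ω, ∑ l, (∑ b, if ω ∈ near b then (0 : ℝ) else |h b l|) * ‖K ω k l‖
      * Real.exp ((κ + δ) * d k l + δ * cr ω) ≤ Φ) (i : Y) :
    0 ≤ C_L * (2 * N / M * K₁ + Φ) := by
  have hN0 : 0 ≤ N := le_trans (by positivity) (hN i)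
  have hK0 : 0 ≤ K₁ := le_trans (Finset.sum_nonneg fun ω _ => Finset.sum_nonneg fun l _ =>
    mul_nonneg (mul_nonneg (norm_nonneg _) (hw.nonneg i l)) (Real.exp_pos _).le) (hK₁ i)
  have hΦ0 : 0 ≤ Φ := le_trans (Finset.sum_nonneg fun ω _ => Finset.sum_nonneg fun l _ =>
    mul_nonneg (mul_nonneg (Finset.sum_nonneg fun b _ => by split_ifs <;> simp [abs_nonneg]) (norm_nonneg _))
      (Real.exp_pos _).le) (hΦ i)
  positivity

/-- **Fibre sums of the majorant**: `Σ_{b₀} Σ_{c⃗ : Fin n → B × Ω} walkMajΩ n b₀ c⃗ (i,j) ≤ N·C_L′·ρ_Ωⁿ`. [folklore] -/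
theorem sum_walkMajΩ_apply_le [Fintype B] [Fintype Ω] (hw : WeightHyp κ d) {δ : ℝ} (cr : Ω → ℝ)
    (K : Ω → Matrix Y Y ℂ) (near : B → Finset Ω) (h : B → Y → ℝ) (E : B → Finset Y) (L : B → Matrix Y Y ℂ)
    (hsupp : ∀ b y, y ∉ E b → h b y = 0) (habs : ∀ b y, |h b y| ≤ 1) {M N C_L K₁ Φ : ℝ} (hM : 0 < M)
    (hLip : ∀ b y y', |h b y - h b y'| ≤ d y y' / M) (hN : ∀ y, ((Finset.univ.filter fun b => y ∈ E b).card : ℝ) ≤ N)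
    (hC : 0 ≤ C_L) (hL : ∀ b, WRS (κ + δ) d (L b) C_L)
    (hK₁ : ∀ k, ∑ ω, ∑ l, ‖K ω k l‖ * d k l * Real.exp ((κ + δ) * d k l + δ * cr ω) ≤ K₁)
    (hΦ : ∀ k, ∑ ω, ∑ l, (∑ b, if ω ∈ near b then (0 : ℝ) else |h b l|) * ‖K ω k l‖
      * Real.exp ((κ + δ) * d k l + δ * cr ω) ≤ Φ) (n : ℕ) (i j : Y) :
    ∑ p : B × (Fin n → B × Ω), walkMajΩ δ d cr h K near L n p.1 p.2 i j
      ≤ N * C_L * (C_L * (2 * N / M * K₁ + Φ)) ^ n := by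
  have hPR : WRS κ d (headMajPSum δ d h L * stepMajΩSum δ d cr h K near L ^ n)
      ((N * C_L) * (C_L * (2 * N / M * K₁ + Φ)) ^ n) :=
    (wrs_headMajPSum h E L hsupp habs hC hN hL).mul hw
      ((wrs_stepMajΩSum hw cr K near h E L hsupp habs hM hLip hN hC hL hK₁ hΦ).pow hw n)
  have h1 := hPR.norm_apply_le' hw i j
  rw [sum_walkMajΩ_eq δ d cr h K near L n, Matrix.sum_apply] at h1
  have hnn : 0 ≤ ∑ b₀, (∑ c : Fin n → B × Ω, walkMajΩ δ d cr h K near L n b₀ c) i j :=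
    Finset.sum_nonneg fun b₀ _ => by
      rw [Matrix.sum_apply]
      exact Finset.sum_nonneg fun c _ => walkMajΩ_nonneg δ d cr h K near L n b₀ c i j
  rw [Real.norm_of_nonneg hnn] at h1
  rw [Fintype.sum_prod_type]
  refine le_trans (le_of_eq (Finset.sum_congr rfl fun b₀ _ => ?_)) h1
  rw [Matrix.sum_apply]

/-- The majorant family is ENTRYWISE SUMMABLE over all ω-walks when `ρ_Ω < 1`. [folklore] -/
theorem summable_decMajΩ [Fintype B] [Fintype Ω] (hw : WeightHyp κ d) {δ A₀ : ℝ} (hA₀ : 0 ≤ A₀) (cr : Ω → ℝ)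
    (K : Ω → Matrix Y Y ℂ) (near : B → Finset Ω) (h : B → Y → ℝ) (E : B → Finset Y) (L : B → Matrix Y Y ℂ)
    (hsupp : ∀ b y, y ∉ E b → h b y = 0) (habs : ∀ b y, |h b y| ≤ 1) {M N C_L K₁ Φ : ℝ} (hM : 0 < M)
    (hLip : ∀ b y y', |h b y - h b y'| ≤ d y y' / M) (hN : ∀ y, ((Finset.univ.filter fun b => y ∈ E b).card : ℝ) ≤ N)
    (hC : 0 ≤ C_L) (hL : ∀ b, WRS (κ + δ) d (L b) C_L)
    (hK₁ : ∀ k, ∑ ω, ∑ l, ‖K ω k l‖ * d k l * Real.exp ((κ + δ) * d k l + δ * cr ω) ≤ K₁)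
    (hΦ : ∀ k, ∑ ω, ∑ l, (∑ b, if ω ∈ near b then (0 : ℝ) else |h b l|) * ‖K ω k l‖
      * Real.exp ((κ + δ) * d k l + δ * cr ω) ≤ Φ)
    (hρ : C_L * (2 * N / M * K₁ + Φ) < 1) (i j : Y) :
    Summable fun w : WalkΩ B Ω => decMajΩ A₀ δ d cr h K near L w i j := by
  have hnn : ∀ w : WalkΩ B Ω, 0 ≤ decMajΩ A₀ δ d cr h K near L w i j := fun w =>
    mul_nonneg hA₀ (walkMajΩ_nonneg δ d cr h K near L w.1 w.2.1 w.2.2 i j)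
  refine (summable_sigma_of_nonneg hnn).2 ⟨fun n => Summable.of_finite, ?_⟩
  have hρ0 := ratio_nonneg hw cr K near h E hM hN hC hK₁ hΦ i
  refine Summable.of_nonneg_of_le (fun n => tsum_nonneg fun p => hnn ⟨n, p⟩) (fun n => ?_)
    ((summable_geometric_of_lt_one hρ0 hρ).mul_left (A₀ * (N * C_L)))
  rw [tsum_fintype]
  simp only [decMajΩ]
  rw [← Finset.mul_sum]
  calc A₀ * ∑ p : B × (Fin n → B × Ω), walkMajΩ δ d cr h K near L n p.1 p.2 i j
      ≤ A₀ * (N * C_L * (C_L * (2 * N / M * K₁ + Φ)) ^ n) := mul_le_mul_of_nonneg_left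
        (sum_walkMajΩ_apply_le hw cr K near h E L hsupp habs hM hLip hN hC hL hK₁ hΦ n i j) hA₀
    _ = A₀ * (N * C_L) * (C_L * (2 * N / M * K₁ + Φ)) ^ n := by ring

/-- **Localised rows of the SUMMED majorant**: `Σ_j (Σ_w decMajΩ w (i,j))·e^{κd(i,j)} ≤ A₀·N·C_L′·(1 − ρ_Ω)⁻¹`. [folklore] -/
theorem row_majSum_decMajΩ_le [Fintype B] [Fintype Ω] (hw : WeightHyp κ d) {δ A₀ : ℝ} (hA₀ : 0 ≤ A₀) (cr : Ω → ℝ)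
    (K : Ω → Matrix Y Y ℂ) (near : B → Finset Ω) (h : B → Y → ℝ) (E : B → Finset Y) (L : B → Matrix Y Y ℂ)
    (hsupp : ∀ b y, y ∉ E b → h b y = 0) (habs : ∀ b y, |h b y| ≤ 1) {M N C_L K₁ Φ : ℝ} (hM : 0 < M)
    (hLip : ∀ b y y', |h b y - h b y'| ≤ d y y' / M) (hN : ∀ y, ((Finset.univ.filter fun b => y ∈ E b).card : ℝ) ≤ N)
    (hC : 0 ≤ C_L) (hL : ∀ b, WRS (κ + δ) d (L b) C_L)
    (hK₁ : ∀ k, ∑ ω, ∑ l, ‖K ω k l‖ * d k l * Real.exp ((κ + δ) * d k l + δ * cr ω) ≤ K₁)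
    (hΦ : ∀ k, ∑ ω, ∑ l, (∑ b, if ω ∈ near b then (0 : ℝ) else |h b l|) * ‖K ω k l‖
      * Real.exp ((κ + δ) * d k l + δ * cr ω) ≤ Φ)
    (hρ : C_L * (2 * N / M * K₁ + Φ) < 1) (i : Y) :
    ∑ j, majSum (decMajΩ A₀ δ d cr h K near L) i j * Real.exp (κ * d i j)
      ≤ A₀ * (N * C_L) * (1 - C_L * (2 * N / M * K₁ + Φ))⁻¹ := by
  set ρ := C_L * (2 * N / M * K₁ + Φ) with hρdef
  have hnn : ∀ (w : WalkΩ B Ω) (j : Y), 0 ≤ decMajΩ A₀ δ d cr h K near L w i j := fun w j =>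
    mul_nonneg hA₀ (walkMajΩ_nonneg δ d cr h K near L w.1 w.2.1 w.2.2 i j)
  have hρ0 : 0 ≤ ρ := ratio_nonneg hw cr K near h E hM hN hC hK₁ hΦ i
  set F : ℕ → Y → ℝ := fun n j => ∑ p : B × (Fin n → B × Ω), decMajΩ A₀ δ d cr h K near L ⟨n, p⟩ i j with hF
  have hFle : ∀ n, ∑ j, F n j * Real.exp (κ * d i j) ≤ A₀ * (N * C_L) * ρ ^ n := by
    intro n
    have hPR : WRS κ d (headMajPSum δ d h L * stepMajΩSum δ d cr h K near L ^ n) ((N * C_L) * ρ ^ n) :=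
      (wrs_headMajPSum h E L hsupp habs hC hN hL).mul hw
        ((wrs_stepMajΩSum hw cr K near h E L hsupp habs hM hLip hN hC hL hK₁ hΦ).pow hw n)
    have h1 := hPR i
    have hrow : ∀ j, F n j = A₀ * (headMajPSum δ d h L * stepMajΩSum δ d cr h K near L ^ n) i j := by
      intro j
      rw [hF, sum_walkMajΩ_eq δ d cr h K near L n, Matrix.sum_apply]
      simp only [decMajΩ]
      rw [← Finset.mul_sum, Fintype.sum_prod_type]
      congr 1
      exact Finset.sum_congr rfl fun b₀ _ => by rw [Matrix.sum_apply]
    have hnonneg : ∀ j, 0 ≤ (headMajPSum δ d h L * stepMajΩSum δ d cr h K near L ^ n) i j := by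
      intro j
      rw [sum_walkMajΩ_eq δ d cr h K near L n, Matrix.sum_apply]
      exact Finset.sum_nonneg fun b₀ _ => by
        rw [Matrix.sum_apply]
        exact Finset.sum_nonneg fun c _ => walkMajΩ_nonneg δ d cr h K near L n b₀ c i j
    calc ∑ j, F n j * Real.exp (κ * d i j)
        = A₀ * wrs κ d (headMajPSum δ d h L * stepMajΩSum δ d cr h K near L ^ n) i := by
          rw [wrs, Finset.mul_sum]
          refine Finset.sum_congr rfl fun j _ => ?_
          rw [hrow j, Real.norm_of_nonneg (hnonneg j)]
          ring
      _ ≤ A₀ * ((N * C_L) * ρ ^ n) := mul_le_mul_of_nonneg_left h1 hA₀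
      _ = A₀ * (N * C_L) * ρ ^ n := by ring
  have hsum := summable_decMajΩ hw hA₀ cr K near h E L hsupp habs hM hLip hN hC hL hK₁ hΦ hρ i
  have hsumF : ∀ j, Summable fun n => F n j := by
    intro j
    have := ((summable_sigma_of_nonneg fun w => hnn w j).1 (hsum j)).2
    refine this.congr fun n => ?_
    rw [tsum_fintype]
  have hmaj : ∀ j, majSum (decMajΩ A₀ δ d cr h K near L) i j = ∑' n, F n j := by
    intro j
    rw [majSum, Summable.tsum_sigma (hsum j)]
    exact tsum_congr fun n => tsum_fintype _
  have hgeo : Summable fun n => A₀ * (N * C_L) * ρ ^ n := (summable_geometric_of_lt_one hρ0 hρ).mul_left _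
  have hrowF : Summable fun n => ∑ j, F n j * Real.exp (κ * d i j) :=
    summable_sum fun j _ => (hsumF j).mul_right _
  calc ∑ j, majSum (decMajΩ A₀ δ d cr h K near L) i j * Real.exp (κ * d i j)
      = ∑ j, ∑' n, F n j * Real.exp (κ * d i j) := Finset.sum_congr rfl fun j _ => by rw [hmaj j, tsum_mul_right]
    _ = ∑' n, ∑ j, F n j * Real.exp (κ * d i j) := (Summable.tsum_finsetSum fun j _ => (hsumF j).mul_right _).symm
    _ ≤ ∑' n, A₀ * (N * C_L) * ρ ^ n := Summable.tsum_le_tsum hFle hrowF hgeo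
    _ = A₀ * (N * C_L) * (1 - ρ)⁻¹ := by rw [tsum_mul_left, tsum_geometric_of_lt_one hρ0 hρ]

/-! ## §3 The hand-off -/

/-- **THE HAND-OFF FOR THE FULL DECORATION.**  Symmetric pseudo-metric `d` (`WeightHyp κ d` + symmetry); partition data
(supports in `□̃_b = E b` of diameter `≤ D`, `|h| ≤ 1`, Lipschitz `1/M`, overlap `N`); kernel pieces `K_ω` block-local on
`D_ω` (`K_ω(k,l) ≠ 0 → k ∈ D_ω`), each domain covered within `D_f` by a thread `thr ω`, step credits
`cr ω ≥ 3·listLen(thr ω) + 2·D_f`; cells with packing `P` at radius `R ≥ r + D, r + D_f`, `0 < r`; the budgets AT RATE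
`κ + κ₁P/r` with the credits folded in: local inverses `C_L′`, credited first moment `K₁″`, credited far mass `Φ`;
smallness `ρ_Ω = C_L′·((2N/M)·K₁″ + Φ) < 1`; frozen values `‖τ(Δ)‖ ≤ e^{κ₁}`, `κ₁ ≥ 0`.  THEN the fully decorated ω-family
with the coordinate `Δ₀` free is ROW DATA on `‖σ‖ < e^{κ₁}` at rate `κ` with majorant `e^{κ₁P}·walkMajΩ (κ₁P/r)` and
constant `e^{κ₁P}·N·C_L′·(1 − ρ_Ω)⁻¹` — volume-free, `Δ₀`- and `τ`-free. [folklore] -/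
theorem rowData_decFamilyΩ [Fintype B] [Fintype Ω] (hw : WeightHyp κ d) (hsymm : ∀ a b, d a b = d b a)
    (K : Ω → Matrix Y Y ℂ) (Dω : Ω → Finset Y) (hK : ∀ ω k l, K ω k l ≠ 0 → k ∈ Dω ω) (near : B → Finset Ω)
    (h : B → Y → ℝ) (E : B → Finset Y) (L : B → Matrix Y Y ℂ) (hsupp : ∀ b y, y ∉ E b → h b y = 0)
    (habs : ∀ b y, |h b y| ≤ 1) {M N C_L K₁ Φ κ₁ r D Df R : ℝ} (hM : 0 < M)
    (hLip : ∀ b y y', |h b y - h b y'| ≤ d y y' / M) (hN : ∀ y, ((Finset.univ.filter fun b => y ∈ E b).card : ℝ) ≤ N)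
    (hC : 0 ≤ C_L) (hκ₁ : 0 ≤ κ₁) (hr : 0 < r) (hRD : r + D ≤ R) (hRf : r + Df ≤ R) (cellOf : Y → Δ) {P : ℕ}
    (hpack : ∀ a : Y, ∃ S : Finset Δ, S.card ≤ P ∧ ∀ z, d a z ≤ R → cellOf z ∈ S)
    (hdiam : ∀ b, ∀ z ∈ E b, ∀ z' ∈ E b, d z z' ≤ D) (thr : Ω → List Y)
    (hthr : ∀ ω, ∀ z ∈ Dω ω, ∃ p ∈ thr ω, d z p ≤ Df) (cr : Ω → ℝ) (hcr : ∀ ω, 3 * listLen d (thr ω) + 2 * Df ≤ cr ω)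
    (hL : ∀ b, WRS (κ + κ₁ * (P / r)) d (L b) C_L)
    (hK₁ : ∀ k, ∑ ω, ∑ l, ‖K ω k l‖ * d k l * Real.exp ((κ + κ₁ * (P / r)) * d k l + κ₁ * (P / r) * cr ω) ≤ K₁)
    (hΦ : ∀ k, ∑ ω, ∑ l, (∑ b, if ω ∈ near b then (0 : ℝ) else |h b l|) * ‖K ω k l‖
      * Real.exp ((κ + κ₁ * (P / r)) * d k l + κ₁ * (P / r) * cr ω) ≤ Φ)
    (hρ : C_L * (2 * N / M * K₁ + Φ) < 1) (τ : Δ → ℂ) (hτ : ∀ δ, ‖τ δ‖ ≤ Real.exp κ₁) (Δ₀ : Δ) :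
    RowData κ d (Real.exp κ₁) (decFamilyΩ cellOf E Dω h K near L τ Δ₀)
      (decMajΩ (Real.exp (κ₁ * P)) (κ₁ * (P / r)) d cr h K near L)
      (Real.exp (κ₁ * P) * (N * C_L) * (1 - C_L * (2 * N / M * K₁ + Φ))⁻¹) where
  ha w i j := by
    simp only [decFamilyΩ, Matrix.smul_apply, smul_eq_mul]
    exact (differentiableOn_monoAt τ Δ₀ _ _).mul (differentiableOn_const _)
  hm w σ hσ i j := by
    rw [decFamilyΩ, Matrix.smul_apply, smul_eq_mul, norm_mul, decMajΩ]
    have hδ : 0 ≤ κ₁ * (P / r) := mul_nonneg hκ₁ (div_nonneg (Nat.cast_nonneg P) hr.le)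
    refine norm_coeff_mul_walkTermΩ_le h E hsupp K Dω hK near L hδ d hw.nonneg hw.tri cr (Real.exp_pos _).le
      w.1 w.2.1 w.2.2 _ (fun y hy => ?_) i j
    have hσ' : ‖σ‖ ≤ Real.exp κ₁ := (mem_ball_zero_iff.1 hσ).le
    refine (norm_monoAt_le hτ Δ₀ _ hσ').trans ?_
    rw [← Real.exp_nat_mul, ← Real.exp_add]
    refine Real.exp_le_exp.2 ?_
    have hcnt := card_decΩ_le d hw.tri hw.zero hw.nonneg hsymm hr hRD hRf cellOf hpack E hdiam Dω thr hthr cr hcr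
      w.2.1 w.2.2 y hy
    have := mul_le_mul_of_nonneg_left hcnt hκ₁
    calc ((decΩ cellOf E Dω w.1 w.2.1 w.2.2).card : ℝ) * κ₁ = κ₁ * (decΩ cellOf E Dω w.1 w.2.1 w.2.2).card :=
          mul_comm _ _
      _ ≤ κ₁ * (P * (1 + (pathLen d w.1 y + crSum cr w.1 w.2.2) / r)) := this
      _ = κ₁ * P + κ₁ * (P / r) * (pathLen d w.1 y + crSum cr w.1 w.2.2) := by ring
  hsum i j := summable_decMajΩ hw (Real.exp_pos _).le cr K near h E L hsupp habs hM hLip hN hC hL hK₁ hΦ hρ i j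
  hρ i := row_majSum_decMajΩ_le hw (Real.exp_pos _).le cr K near h E L hsupp habs hM hLip hN hC hL hK₁ hΦ hρ i

/-! ## §4 At `s ≡ 1` the summed family is the inverse -/

omit [DecidableEq Ω] in
/-- Generic inverse formula: `(1 + K′)·P₀ = 1 − R`, `WRS κ d R ρ`, `ρ < 1` ⟹ `1 + K′` invertible and `(1 + K′)⁻¹ = P₀·(1 − R)⁻¹`
(as `UnitLatticeWalkInversion.inv_one_add_eq`, for an arbitrary remainder). [folklore] -/
theorem inv_one_add_eq' (hw : WeightHyp κ d) {K' P₀ R : Matrix Y Y ℂ} {ρ : ℝ} (hid : (1 + K') * P₀ = 1 - R)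
    (hR : WRS κ d R ρ) (hρ : ρ < 1) : IsUnit (1 + K') ∧ (1 + K')⁻¹ = P₀ * (1 - R)⁻¹ := by
  have hU : IsUnit (1 - R) := isUnit_one_sub hw hR hρ
  have hdet : IsUnit (1 - R).det := (Matrix.isUnit_iff_isUnit_det _).1 hU
  have hright : (1 + K') * (P₀ * (1 - R)⁻¹) = 1 := by
    rw [← Matrix.mul_assoc, hid, Matrix.mul_nonsing_inv _ hdet]
  refine ⟨(Matrix.isUnit_iff_isUnit_det _).2 (Matrix.isUnit_det_of_right_inverse hright), ?_⟩
  exact Matrix.inv_eq_right_inv hright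

/-- **`termSum (decFamilyΩ … 1 Δ₀) 1 = (1 + Ktot K)⁻¹`**: at `τ ≡ 1`, `σ = 1` every coefficient is `1`, the family is the
ω-expansion to all orders, and its sum is `Ptot·(1 − Rem₂)⁻¹ = (1 + Σ_ω K_ω)⁻¹` — entrywise summability from ANY row data
of the family whose disc contains `1` (`κ₁ > 0`), the resummation identity `(1 + Ktot K)·Ptot = 1 − Rem₂`
(`UnitLatticeOmegaTerms.resummation_identity₂`), and `AnalyticWalkSum216Neumann.hasSum_pow_apply` BY NAME. [folklore] -/
theorem termSum_decFamilyΩ_one [Fintype B] [Fintype Ω] (hw : WeightHyp κ d) {K : Ω → Matrix Y Y ℂ}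
    {near : B → Finset Ω} {h : B → Y → ℝ} {L : B → Matrix Y Y ℂ} {ρR Rd ρ : ℝ}
    (hid : (1 + Ktot K) * Ptot h L = 1 - Rem₂ h K near L) (hRem : WRS κ d (Rem₂ h K near L) ρR) (hρR : ρR < 1)
    (cellOf : Y → Δ) (E : B → Finset Y) (Dω : Ω → Finset Y) (Δ₀ : Δ) {m : WalkΩ B Ω → Y → Y → ℝ}
    (hRD : RowData κ d Rd (decFamilyΩ cellOf E Dω h K near L (fun _ => (1 : ℂ)) Δ₀) m ρ)
    (h1 : (1 : ℂ) ∈ ball (0 : ℂ) Rd) :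
    termSum (decFamilyΩ cellOf E Dω h K near L (fun _ => (1 : ℂ)) Δ₀) 1 = (1 + Ktot K)⁻¹ := by
  have hfam : ∀ (w : WalkΩ B Ω) (i j : Y), decFamilyΩ cellOf E Dω h K near L (fun _ => (1 : ℂ)) Δ₀ w 1 i j
      = walkTermΩ h K near L w.1 w.2.1 w.2.2 i j := by
    intro w i j
    rw [decFamilyΩ, monoAt_one, one_smul]
  ext i j
  rw [termSum, (inv_one_add_eq' hw hid hRem hρR).2]
  have hsum : Summable fun w : WalkΩ B Ω => walkTermΩ h K near L w.1 w.2.1 w.2.2 i j :=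
    (hRD.summable h1 i j).congr fun w => hfam w i j
  have hfib : ∀ n : ℕ, HasSum (fun p : B × (Fin n → B × Ω) => walkTermΩ h K near L n p.1 p.2 i j)
      ((Ptot h L * Rem₂ h K near L ^ n) i j) := by
    intro n
    rw [Ptot_mul_Rem₂_pow, Matrix.sum_apply]
    have : (∑ b₀, (∑ c : Fin n → B × Ω, walkTermΩ h K near L n b₀ c) i j)
        = ∑ p : B × (Fin n → B × Ω), walkTermΩ h K near L n p.1 p.2 i j := by
      rw [Fintype.sum_prod_type]
      exact Finset.sum_congr rfl fun b₀ _ => by rw [Matrix.sum_apply]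
    rw [this]
    exact hasSum_fintype _
  have hord : HasSum (fun n : ℕ => (Ptot h L * Rem₂ h K near L ^ n) i j) ((Ptot h L * (1 - Rem₂ h K near L)⁻¹) i j) := by
    simp only [Matrix.mul_apply]
    exact hasSum_sum fun k _ => (hasSum_pow_apply hw hRem hρR k j).mul_left (Ptot h L i k)
  have htot : HasSum (fun w : WalkΩ B Ω => walkTermΩ h K near L w.1 w.2.1 w.2.2 i j)
      ((Ptot h L * (1 - Rem₂ h K near L)⁻¹) i j) :=
    HasSum.sigma_of_hasSum hord (fun n => hfib n) hsum
  rw [show (fun w : WalkΩ B Ω => decFamilyΩ cellOf E Dω h K near L (fun _ => (1 : ℂ)) Δ₀ w 1 i j)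
      = fun w : WalkΩ B Ω => walkTermΩ h K near L w.1 w.2.1 w.2.2 i j from funext fun w => hfam w i j]
  exact htot.tsum_eq

end Wrs

end

end Summit.QuantumFields.BalabanUV.Beta.UnitLatticeOmegaRowData
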